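import Summits.ValiantsHypothesis.ValiantsHypothesis.Theorems.BarrierLeverAnchoredDoorHitsLowerPairsMoveResidual
import Summits.ValiantsHypothesis.ValiantsHypothesis.Theorems.BarrierLeverAnchoredDoorHitsLowerPairsThinStep

/-!
# Support item `AnchoredDoorHitsLowerPairs` (stmt-ValiantsHypothesis-22510), line `anchored-peeling`:
# THE KERNEL-MOVE INDUCTION WITH THIN STEPS — star ∨ gap-one (vertex/face, both sides) ∨ thin vertex (both sides) ∨ residual ⟹ the item

Helper file (`--supports stmt-ValiantsHypothesis-22510`; cell valiant-natproofs, rung V4, 𝒟-side door (c); registered line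
`Cruxes/AnchoredDoorHitsLowerPairs/Lines/anchored_peeling.lean` v13; prover seat val-np-p1 gen 19). One `def … : Prop` (`Stmt.stub_moveThinResidual`, OFFERED,
NOT asserted) and the kernel composition; every other ingredient is PROVED: `stub_base`, `stub_starStep` (p580598), the gap-one moves (…GapOneFaceMove),
the thin vertex step `symbolicDet_ne_zero_of_thin` (val-np-p2 g11, …ThinStep), `stub_genericPoint`.

Compared with `Stmt.stub_moveResidual` (…MoveResidual) the residual additionally excludes pairs with a THIN vertex on either side (`1 ≤ ℓ_a ≤ #vertices` of the
other complex), which removes the «deep versus very wide» pairs `(2^{[n]}, C)` with `#vertices(C) ≥ 2^{n−1}` (branch (ii) of memo PEEL-HALL §19 in that range).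

* `Stmt.stub_moveThinResidual`, `symbolicDet_ne_zero_of_moveThinResidual`, `anchoredDoorHitsLowerPairs_of_moveThinResidual : stub → AnchoredDoorHitsLowerPairs`.

WHAT THIS IS NOT: the residual is NOT proved (cube/ball pairs with k > s remain); nothing on crux stmt-ValiantsHypothesis-14610 or on `VP` versus `VNP`.
-/

set_option linter.dupNamespace false

namespace Summit.ValiantsHypothesis.ValiantsHypothesis.Theorems.BarrierLever.AnchoredPeeling

open Finset

noncomputable section

/-- **STUB (MOVE+THIN RESIDUAL; offered, not asserted).** ∃ s ≥ 1: injective lower pairs with `r ≥ 2` admitting no star step, no gap-one step (either side) and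
no thin vertex (either side) have `symbolicDet_s ≠ 0`. -/
def Stmt.stub_moveThinResidual : Prop :=
  ∃ s : ℕ, 1 ≤ s ∧ ∀ (h r : ℕ) (u w : Fin r → Finset (Fin h)), Function.Injective u → Function.Injective w →
    IsLowerSet (Set.range u) → IsLowerSet (Set.range w) → 2 ≤ r →
    (¬ ∃ Z W : Finset (Fin h), Z ∈ Set.range u ∧ W ∈ Set.range w ∧ 1 ≤ Z.card ∧ 1 ≤ W.card ∧ (Z.card ≤ s ∨ W.card ≤ s) ∧
        (Finset.univ.filter (fun i => Z ⊆ u i)).card = (Finset.univ.filter (fun j => W ⊆ w j)).card) →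
    (¬ ∃ (a c : Fin h) (D : Finset (Fin h)), c ∉ D ∧ (insert c D).card ≤ s ∧
        Fintype.card {i : Fin r // ¬ (a ∈ u i)} = Fintype.card {j : Fin r // ¬ (insert c D ⊆ w j)} + 1) →
    (¬ ∃ (c a : Fin h) (B : Finset (Fin h)), a ∉ B ∧ (insert a B).card ≤ s ∧
        Fintype.card {j : Fin r // ¬ (c ∈ w j)} = Fintype.card {i : Fin r // ¬ (insert a B ⊆ u i)} + 1) →
    (¬ ∃ a : Fin h, (∃ i, a ∈ u i) ∧ (Finset.univ.filter (fun i => a ∈ u i)).card ≤ (Finset.univ.filter (fun c : Fin h => ∃ j, w j = {c})).card) →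
    (¬ ∃ c : Fin h, (∃ j, c ∈ w j) ∧ (Finset.univ.filter (fun j => c ∈ w j)).card ≤ (Finset.univ.filter (fun a : Fin h => ∃ i, u i = {a})).card) →
    symbolicDet s h r u w ≠ 0

variable {h : ℕ}

/-- The deletion family of a star is a lower family with fewer members (bookkeeping for the star step's first hypothesis). -/
private theorem starStep_H0 {s r : ℕ} {u w : Fin r → Finset (Fin h)}
    (hlu : IsLowerSet (Set.range u)) (hlw : IsLowerSet (Set.range w)) {Z W : Finset (Fin h)} (hZ : Z ∈ Set.range u)
    (IH : ∀ r' < r, ∀ (u' w' : Fin r' → Finset (Fin h)), Function.Injective u' → Function.Injective w' →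
      IsLowerSet (Set.range u') → IsLowerSet (Set.range w') → symbolicDet s h r' u' w' ≠ 0)
    (r₀ : ℕ) (u₀ w₀ : Fin r₀ → Finset (Fin h)) (hu₀ : Function.Injective u₀) (hw₀ : Function.Injective w₀)
    (hru : Set.range u₀ = {S | S ∈ Set.range u ∧ ¬ Z ⊆ S}) (hrw : Set.range w₀ = {T | T ∈ Set.range w ∧ ¬ W ⊆ T}) :
    symbolicDet s h r₀ u₀ w₀ ≠ 0 := by
  classical
  have hmem : ∀ k, ∃ i, u i = u₀ k := fun k => by
    have : u₀ k ∈ Set.range u₀ := ⟨k, rfl⟩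
    rw [hru] at this
    exact this.1
  choose g hg using hmem
  have hg_inj : Function.Injective g := fun k k' hkk => hu₀ (by rw [← hg k, ← hg k', hkk])
  obtain ⟨iZ, hiZ⟩ := hZ
  have hg_ns : ¬ Function.Surjective g := by
    intro hsurj
    obtain ⟨k, hk⟩ := hsurj iZ
    have : u₀ k ∈ Set.range u₀ := ⟨k, rfl⟩
    rw [hru] at this
    exact this.2 (by rw [← hg k, hk, hiZ])
  have hlt : r₀ < r := by simpa using Fintype.card_lt_of_injective_not_surjective g hg_inj hg_ns
  refine IH r₀ hlt u₀ w₀ hu₀ hw₀ ?_ ?_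
  · intro S S' hS'S hS
    rw [hru] at hS ⊢
    exact ⟨hlu hS'S hS.1, fun hZS' => hS.2 (hZS'.trans hS'S)⟩
  · intro T T' hT'T hT
    rw [hrw] at hT ⊢
    exact ⟨hlw hT'T hT.1, fun hWT' => hT.2 (hWT'.trans hT'T)⟩

/-- The link family of a nonempty star is a lower family with fewer members (bookkeeping for the star step's second hypothesis). -/
private theorem starStep_H1 {s r : ℕ} {u w : Fin r → Finset (Fin h)}
    (hlu : IsLowerSet (Set.range u)) (hlw : IsLowerSet (Set.range w)) {Z W : Finset (Fin h)} (hZ : Z ∈ Set.range u) (hZ1 : 1 ≤ Z.card)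
    (IH : ∀ r' < r, ∀ (u' w' : Fin r' → Finset (Fin h)), Function.Injective u' → Function.Injective w' →
      IsLowerSet (Set.range u') → IsLowerSet (Set.range w') → symbolicDet s h r' u' w' ≠ 0)
    (r₁ : ℕ) (u₁ w₁ : Fin r₁ → Finset (Fin h)) (hu₁ : Function.Injective u₁) (hw₁ : Function.Injective w₁)
    (hru : Set.range u₁ = {S | Disjoint S Z ∧ S ∪ Z ∈ Set.range u}) (hrw : Set.range w₁ = {T | Disjoint T W ∧ T ∪ W ∈ Set.range w}) :
    symbolicDet s h r₁ u₁ w₁ ≠ 0 := by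
  classical
  have hmem : ∀ k, ∃ i, u i = u₁ k ∪ Z := fun k => by
    have : u₁ k ∈ Set.range u₁ := ⟨k, rfl⟩
    rw [hru] at this
    obtain ⟨i, hi⟩ := this.2
    exact ⟨i, hi⟩
  have hdisj : ∀ k, Disjoint (u₁ k) Z := fun k => by
    have : u₁ k ∈ Set.range u₁ := ⟨k, rfl⟩
    rw [hru] at this
    exact this.1
  choose g hg using hmem
  have hg_inj : Function.Injective g := fun k k' hkk => hu₁ (by
    have := hg k
    rw [hkk, hg k'] at this
    rw [← Finset.union_sdiff_cancel_right (hdisj k), ← Finset.union_sdiff_cancel_right (hdisj k'), this])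
  -- the empty face of `R` is not of the form `S ∪ Z`
  obtain ⟨iZ, hiZ⟩ := hZ
  obtain ⟨i0, hi0⟩ : (∅ : Finset (Fin h)) ∈ Set.range u := hlu (Finset.empty_subset Z) ⟨iZ, hiZ⟩
  have hg_ns : ¬ Function.Surjective g := by
    intro hsurj
    obtain ⟨k, hk⟩ := hsurj i0
    have hZe : Z = ∅ := Finset.subset_empty.mp (by rw [← hi0, ← hk, hg k]; exact Finset.subset_union_right)
    rw [hZe, Finset.card_empty] at hZ1
    omega
  have hlt : r₁ < r := by simpa using Fintype.card_lt_of_injective_not_surjective g hg_inj hg_ns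
  refine IH r₁ hlt u₁ w₁ hu₁ hw₁ ?_ ?_
  · intro S S' hS'S hS
    rw [hru] at hS ⊢
    exact ⟨Finset.disjoint_of_subset_left hS'S hS.1, hlu (Finset.union_subset_union hS'S subset_rfl) hS.2⟩
  · intro T T' hT'T hT
    rw [hrw] at hT ⊢
    exact ⟨Finset.disjoint_of_subset_left hT'T hT.1, hlw (Finset.union_subset_union hT'T subset_rfl) hT.2⟩

/-- The thin step's deletion hypothesis from the strong induction hypothesis. -/
private theorem thin_hdel {s r : ℕ} {u w : Fin r → Finset (Fin h)} (hlu : IsLowerSet (Set.range u)) {a : Fin h} (ha : ∃ i, a ∈ u i)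
    (IH : ∀ r' < r, ∀ (u' w' : Fin r' → Finset (Fin h)), Function.Injective u' → Function.Injective w' →
      IsLowerSet (Set.range u') → IsLowerSet (Set.range w') → symbolicDet s h r' u' w' ≠ 0)
    (r₀ : ℕ) (u₀ w₀ : Fin r₀ → Finset (Fin h)) (hu₀ : Function.Injective u₀) (hw₀ : Function.Injective w₀)
    (hru : Set.range u₀ = {S | S ∈ Set.range u ∧ a ∉ S}) (_hrw : Set.range w₀ ⊆ Set.range w) (hlw₀ : IsLowerSet (Set.range w₀)) :
    symbolicDet s h r₀ u₀ w₀ ≠ 0 := by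
  classical
  have hmem : ∀ k, ∃ i, u i = u₀ k := fun k => by
    have : u₀ k ∈ Set.range u₀ := ⟨k, rfl⟩
    rw [hru] at this
    exact this.1
  choose g hg using hmem
  have hg_inj : Function.Injective g := fun k k' hkk => hu₀ (by rw [← hg k, ← hg k', hkk])
  obtain ⟨ia, hia⟩ := ha
  have hg_ns : ¬ Function.Surjective g := by
    intro hsurj
    obtain ⟨k, hk⟩ := hsurj ia
    have : u₀ k ∈ Set.range u₀ := ⟨k, rfl⟩
    rw [hru] at this
    exact this.2 (by rw [← hg k, hk]; exact hia)
  have hlt : r₀ < r := by simpa using Fintype.card_lt_of_injective_not_surjective g hg_inj hg_ns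
  refine IH r₀ hlt u₀ w₀ hu₀ hw₀ ?_ hlw₀
  intro S S' hS'S hS
  rw [hru] at hS ⊢
  exact ⟨hlu hS'S hS.1, fun ha' => hS.2 (hS'S ha')⟩

/-- **THE KERNEL-MOVE INDUCTION WITH THIN STEPS**: base, star step, gap-one steps (both sides), thin vertex steps (both sides), residual. -/
theorem symbolicDet_ne_zero_of_moveThinResidual (H : Stmt.stub_moveThinResidual) :
    ∃ s : ℕ, 1 ≤ s ∧ ∀ (h r : ℕ) (u w : Fin r → Finset (Fin h)), Function.Injective u → Function.Injective w →
      IsLowerSet (Set.range u) → IsLowerSet (Set.range w) → symbolicDet s h r u w ≠ 0 := by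
  classical
  obtain ⟨s, hs, H⟩ := H
  refine ⟨s, hs, fun h r => ?_⟩
  induction r using Nat.strong_induction_on with
  | _ r ih =>
    intro u w hu hw hlu hlw
    by_cases hr : r ≤ 1
    · exact stub_base s h r u w hu hw hlu hlw hr
    have hr2 : 2 ≤ r := by omega
    by_cases hstar : ∃ Z W : Finset (Fin h), Z ∈ Set.range u ∧ W ∈ Set.range w ∧ 1 ≤ Z.card ∧ 1 ≤ W.card ∧ (Z.card ≤ s ∨ W.card ≤ s) ∧
        (Finset.univ.filter (fun i => Z ⊆ u i)).card = (Finset.univ.filter (fun j => W ⊆ w j)).card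
    · obtain ⟨Z, W, hZ, hW, hZ1, hW1, hsmall, hcount⟩ := hstar
      refine stub_starStep s h r u w hu hw hlu hlw Z W hZ hW hZ1 hW1 hsmall hcount ?_ ?_
      · exact fun r₀ u₀ w₀ hu₀ hw₀ hru hrw => starStep_H0 hlu hlw hZ ih r₀ u₀ w₀ hu₀ hw₀ hru hrw
      · intro r₁ u₁ w₁ hu₁ hw₁ hru hrw
        exact starStep_H1 hlu hlw hZ hZ1 ih r₁ u₁ w₁ hu₁ hw₁ hru hrw
    by_cases hgx : ∃ (a c : Fin h) (D : Finset (Fin h)), c ∉ D ∧ (insert c D).card ≤ s ∧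
        Fintype.card {i : Fin r // ¬ (a ∈ u i)} = Fintype.card {j : Fin r // ¬ (insert c D ⊆ w j)} + 1
    · obtain ⟨a, c, D, hcD, hF, hgap⟩ := hgx
      exact symbolicDet_ne_zero_of_gapOneFace_lower hs hu hw hlu hlw hcD hF hgap ih
    by_cases hgy : ∃ (c a : Fin h) (B : Finset (Fin h)), a ∉ B ∧ (insert a B).card ≤ s ∧
        Fintype.card {j : Fin r // ¬ (c ∈ w j)} = Fintype.card {i : Fin r // ¬ (insert a B ⊆ u i)} + 1
    · obtain ⟨c, a, B, haB, hF, hgap⟩ := hgy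
      exact symbolicDet_ne_zero_of_gapOneFace_lower_swap hs hu hw hlu hlw haB hF hgap ih
    by_cases htx : ∃ a : Fin h, (∃ i, a ∈ u i) ∧
        (Finset.univ.filter (fun i => a ∈ u i)).card ≤ (Finset.univ.filter (fun c : Fin h => ∃ j, w j = {c})).card
    · obtain ⟨a, ha, hthin⟩ := htx
      exact ThinStep.symbolicDet_ne_zero_of_thin s h r hs u w hu hw hlw a hthin
        (fun r₀ u₀ w₀ hu₀ hw₀ hru hrw hlw₀ => thin_hdel hlu ha ih r₀ u₀ w₀ hu₀ hw₀ hru hrw hlw₀)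
    by_cases hty : ∃ c : Fin h, (∃ j, c ∈ w j) ∧
        (Finset.univ.filter (fun j => c ∈ w j)).card ≤ (Finset.univ.filter (fun a : Fin h => ∃ i, u i = {a})).card
    · obtain ⟨c, hc, hthin⟩ := hty
      rw [symbolicDet_ne_zero_comm]
      exact ThinStep.symbolicDet_ne_zero_of_thin s h r hs w u hw hu hlu c hthin
        (fun r₀ u₀ w₀ hu₀ hw₀ hru hrw hlw₀ => thin_hdel hlw hc
          (fun r' hr' u' w' hu' hw' hlu' hlw' => (symbolicDet_ne_zero_comm s h r' w' u').mp (ih r' hr' w' u' hw' hu' hlw' hlu'))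
          r₀ u₀ w₀ hu₀ hw₀ hru hrw hlw₀)
    exact H h r u w hu hw hlu hlw hr2 hstar hgx hgy htx hty

/-- **The move+thin residual implies the line's symbolic non-vanishing stub** (`h₀ = 0`). -/
theorem stub_symbolicNonvanishing_of_moveThinResidual (H : Stmt.stub_moveThinResidual) : Stmt.stub_symbolicNonvanishing := by
  obtain ⟨s, -, K⟩ := symbolicDet_ne_zero_of_moveThinResidual H
  exact ⟨s, 0, fun h _ r u w hu hw hlu hlw => K h r u w hu hw hlu hlw⟩

/-- **COMPOSITION (kernel-checked): the move+thin residual ALONE implies the item = route decl `AnchoredDoorHitsLowerPairs`.** -/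
theorem anchoredDoorHitsLowerPairs_of_moveThinResidual (H : Stmt.stub_moveThinResidual) :
    Summit.ValiantsHypothesis.ValiantsHypothesis.Theses.BarrierLever.AnchoredDoorHitsLowerPairs := by
  obtain ⟨s, -, K⟩ := symbolicDet_ne_zero_of_moveThinResidual H
  exact ⟨s, 0, fun h _ r u w hu hw hlu hlw => stub_genericPoint s h r u w (K h r u w hu hw hlu hlw)⟩

end

end Summit.ValiantsHypothesis.ValiantsHypothesis.Theorems.BarrierLever.AnchoredPeeling
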